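import Literature.MathematicalPhysics.QuantumFieldTheory.Balaban1983to89.B9Thm37GlueTorus
import Literature.MathematicalPhysics.QuantumFieldTheory.Balaban1983to89.B9Ineq347
import Literature.MathematicalPhysics.QuantumFieldTheory.Balaban1983to89.B9Eq357QprimeTowerKernelForm
import Literature.MathematicalPhysics.QuantumFieldTheory.Balaban1983to89.B9Eq349LaplacePrimeBlockLetters

/-!
# `Balaban1983to89.B9Eq341TowerBlockGeometry` — T. Bałaban, *Propagators for lattice gauge theories in a background field*, Commun. Math. Phys. **99** (1985)
# 389–434 [Balaban1985BackgroundPropagators] (3.41) p. 397 («y ∈ 𝔅 = ⋃_j Λ_j … d(y, y′)») with [Balaban1984PropagatorsII] (2.1)–(2.4) p. 224, (2.46) p. 231, (2.54) p. 233,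
# Lemma 2.1 (2.61) p. 234: **THE ONE-SCALE COARSE GEOMETRY OF THE SMALL-FIELD `k`-TH STEP ON THE TORUS** — sites the unit torus `T_m` (= the big blocks `B^k(y)` of
# `T_{L^k m}`, `k = n+1`), EVERY site of scale `k` (no large-field regions: `Ω_j = T` for all `j`, `Λ_k = T_m`), length `L^kη`, distance the `ℓ¹` torus distance; its
# axioms, [4] Lemma 2.1 (2.61) FOR EVERY EXPONENT (one scale: no condition (2.59)), the p. 398 scale transfers (trivial: constant length), the stencil range of the block map
# `blkK` — the geometry binders of `B9Thm34SectBUniform(R1).thm34_Gp_uniform` for the NE9 chain, DISCHARGED; junction item (j1) of the NE9 lineage's route memo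
# `ROUTE-J-VIA-THM34-g98.md`

statement-level skeleton of published theorems with citation tags; proofs where landed; nothing here is a claim about the Yang–Mills mass gap

CITATION HEADER (lean-in-tree rule).  Audit cell `pub-balaban`, sub-cell `t4`, BINDER row NE9; NE9 crux-team LEAF PROVER 01 (`b2b-balaban-t4-ne9-formalise-leaf-01`,
gen 99; bears_on: R4/N22).  Vocabulary BY NAME: `B9.Geometry` ∕ `B9Thm34Ext.toB6` (cell lit-balaban, r06), `B6RandomWalk.Triangle254` ∕ `Ineq261` ∕ `B6.c1` (pv08), `B9Ineq347.ScaleTransfer`,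
pv21's one-scale torus lineage `B9Thm37GlueTorus` (`tdist1`, `tdist1_triangle`, `tdist1_comm`, `tdist1_self`, `tdist1_nonneg`, `torusSum_tdist1_le`, `c0_pow_le_c1` — the model
here is its constant-scale-`k` twin on `TSite d m`; `B5TorusCover.UT m` is `TSite d m` by definition), `B4Sect5Torus.tdist` ∕ `ccoord`, this lineage's
`B9Eq357QprimeTowerKernelForm.blkK`, `B9Eq316TowerFlatIsOneStep.siteCast` ∕ `towerP_eq_fineP_pow`, `B9Eq349LaplacePrimeBlockLetters.tdist_blockCoord_shift_le_one`.  Sources read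
through those files' verbatim quotations: [Balaban1985BackgroundPropagators] p. 397 (3.41), p. 398 (after (3.47)), p. 399 «the constants … do not depend on the sequence {Ω_j}»;
[Balaban1984PropagatorsII] pp. 224, 231, 233–234.  [folklore] model bookkeeping; NOTHING of print's estimates is asserted.

WHAT IS PROVED (sorry-free; ONE `def` with body — the geometry — and theorems).
* §1 MODEL `towerGeom L m n η M : B9.Geometry` (sites `TSite d m`, `scale ≡ n+1`, `dist = tdist1 m` (`ℓ¹`), `eta = η`, `L = L`; localisation vocabulary trivial, as pv21's `torusGeom`);
  `len_towerGeom` (`len ≡ L^{n+1}η`), `dist_towerGeom`; the axioms `htri_towerGeom` ((2.54)), `hrefl_towerGeom`, `hsym_towerGeom`, `hdnn_towerGeom`, `hlen_towerGeom` (`0 < len`),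
  `hlenη_towerGeom` (`η ≤ len` for `1 ≤ L`).
* §2 **`h261_towerGeom`** — (2.61) with print's `c₁(α) = 12c₀(½α)^d` for EVERY `α, δ₀ > 0`, every torus size (pv21's factorisation `torusSum_tdist1_le` + `c0_pow_le_c1`);
  `h261_towerGeom_R1` (the `9/5000 ≤ α < 1` form of the R1 theorems).
* §3 `scaleTransfer_const` (a constant weight transfers with any constant `Λ ≥ 1` at any rate `αδ₀ ≥ 0`), **`hST_towerGeom`** (the six transfers of `thm34_Gp_uniform` with
  `Λf ≡ 1`: `len`, `len²`, `len⁻¹`, `len⁻²`, `len⁻⁴`, `len^{−4}` are constant).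
* §4 STENCIL RANGE of the `k`-level block map: `tdist1_le_card_mul_tdist` (`ℓ¹ ≤ d·ℓ^∞`), `blkK_eq_blockCoord_siteCast`, **`dist_blkK_shift_le`** ∕ **`dist_blkK_shift_symm_le`**
  (`d(blkK x, blkK (x ± e_μ)) ≤ d` — r06's `hd₀F`∕`hd₀B` with `d₀ := d`), `dist_self_le` (`hd₀0`).
HONEST SCOPE.  A MODEL (definition lane): the small-field `k`-th step's coarse geometry at print's point, with the `ℓ¹` torus distance (print fixes no norm; the NE9 chain's decay
letters use the sup distance `tdist`, dominated through `e^{−δ·d₁} ≤ e^{−δ·d_∞}` at read-back); no estimate of the paper beyond [4] (2.61) at one scale; NE9 NOT PRINTED ∕ NOT PROVED;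
spine PROVED 0∕9; rung (B)+1 finite T⁴ — NOT infinite volume, NOT mass gap, NOT BetaPertH, NOT Clay.  HONEST DEPENDENCY: continuum YM on T⁴ ⇐ BetaPertH ∧ nine spine estimates (0/9
proved); BetaPertH ⇐ (D1) ∧ (D4) ∧ CAP+tail; G-an2-4 gates asym, D1 and NE2/3/4.  NEW file; nothing modified.  RELATED, NOT DUPLICATED: pv21's `B9Thm37GlueTorus.torusGeom`
(scale `0`, length `η`: the `j = 0` member; this file is the `j = k` member with length `L^kη`), p21's `B9Thm314GpFlatTorusGeometry` (TWO nested multi-level families on matrices —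
a different carrier).  Net new unproved facts: 0.
-/

noncomputable section

open scoped BigOperators

namespace Literature.MathematicalPhysics.QuantumFieldTheory.Balaban1983to89.B9Eq341TowerBlockGeometry

open B4Sect5Torus (TSite tdist ccoord)
open B9SectCLatticeCarrier (Bond shift unshift)
open B6RandomWalk (Triangle254 Ineq261)
open B9Thm34Ext (toB6)
open B9Ineq347 (ScaleTransfer)
open B9Thm37GlueTorus (tdist1 tdist1_self tdist1_comm tdist1_triangle tdist1_nonneg torusSum_tdist1_le c0_pow_le_c1)
open B9Eq319QprimeTorus (fineP blockCoord)
open B9Eq315QTower (towerP)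
open B9Eq316TowerFlatIsOneStep (siteCast siteCast_apply_val towerP_eq_fineP_pow)
open B9Eq357QprimeTowerKernelForm (blkK blkK_apply_val)
open B9Eq33CovDerivVector (shiftEquiv)
open B9Eq349LaplacePrimeBlockLetters (tdist_blockCoord_shift_le_one)

variable {d : ℕ} (L : ℕ) [NeZero L] (m : Fin d → ℕ) [∀ i, NeZero (m i)] (n : ℕ)

/-! ## §1 The model and its axioms -/

/-- MODEL. **The one-scale coarse geometry of the small-field `k`-th step on the torus** (`k = n+1`): sites the unit torus `T_m` (the labels `y` of the big blocks `B^k(y)`),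
every site of scale `k`, length `L^kη`, distance the `ℓ¹` torus distance `d₁(y, y′) = Σ_i dist(y_i − y′_i, m_iℤ)` (the `j = k` member of [4] (2.46) read in units of the block
lattice); the localisation vocabulary (`Loc`, `Cut`, norms) is trivial data, never read by the Sect. B programme's `toB6`-level theorems.
[cite: Balaban1985BackgroundPropagators, (3.41) p.397; Balaban1984PropagatorsII, (2.1)–(2.4) p.224, (2.46) p.231] -/
abbrev towerGeom (η M : ℝ) : B9.Geometry where
  Site := TSite d m
  scale := fun _ => n + 1
  dist := fun y y' => tdist1 m y y'
  k := n + 1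
  eta := η
  L := L
  M := M
  Loc := Unit
  suppIn := fun _ _ => True
  suppInT := fun _ _ => True
  supNorm := fun _ => 0
  l2Norm := fun _ => 0
  wNorm := fun _ _ => 0
  holder := fun _ _ => 0
  Cut := Unit
  cutIn := fun _ _ => True
  cutInT := fun _ _ => True
  cutH := fun _ _ => 0
  cutSup := fun _ => 0
  suppInT_of_suppIn := fun _ _ h => h
  cutInT_of_cutIn := fun _ _ h => h

variable (η M : ℝ)

omit [NeZero L] in
/-- Every length is `L^{n+1}η` (`(3.41): L^jη, y ∈ Λ_j`, here `Λ_k = T_m`). [cite: Balaban1985BackgroundPropagators, (3.41) p.397] -/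
theorem len_towerGeom (y : (towerGeom L m n η M).Site) : (towerGeom L m n η M).len y = (L : ℝ) ^ (n + 1) * η := by
  simp [B9.Geometry.len]

omit [NeZero L] in
/-- The distance is the `ℓ¹` torus distance `tdist1`. [cite: Balaban1984PropagatorsII, (2.46) p.231] -/
theorem dist_towerGeom (y y' : (towerGeom L m n η M).Site) : (towerGeom L m n η M).dist y y' = tdist1 m y y' := rfl

omit [NeZero L] in
/-- **(2.54)** for the model. [cite: Balaban1984PropagatorsII, (2.54) p.233] -/
theorem htri_towerGeom (R : ℝ) (H : Prop) : Triangle254 (toB6 (towerGeom L m n η M) R H) :=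
  fun a b c => tdist1_triangle (N := m) a b c

omit [NeZero L] in
/-- `d(y, y) = 0`. [folklore] [cite: Balaban1984PropagatorsII, (2.46) p.231] -/
theorem hrefl_towerGeom : ∀ y : (towerGeom L m n η M).Site, (towerGeom L m n η M).dist y y = 0 :=
  fun y => tdist1_self (N := m) y

omit [NeZero L] in
/-- `d` is symmetric. [folklore] [cite: Balaban1984PropagatorsII, (2.46) p.231] -/
theorem hsym_towerGeom : ∀ y y' : (towerGeom L m n η M).Site, (towerGeom L m n η M).dist y y' = (towerGeom L m n η M).dist y' y :=
  fun y y' => tdist1_comm (N := m) y y'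

omit [NeZero L] in
/-- `0 ≤ d`. [folklore] [cite: Balaban1984PropagatorsII, (2.46) p.231] -/
theorem hdnn_towerGeom : ∀ y y' : (towerGeom L m n η M).Site, 0 ≤ (towerGeom L m n η M).dist y y' :=
  fun y y' => tdist1_nonneg (N := m) y y'

/-- `0 < len` for `0 < η`. [cite: Balaban1985BackgroundPropagators, (3.41) p.397] -/
theorem hlen_towerGeom (hη : 0 < η) : ∀ y : (towerGeom L m n η M).Site, 0 < (towerGeom L m n η M).len y := fun y => by
  rw [len_towerGeom]
  exact mul_pos (pow_pos (by exact_mod_cast Nat.pos_of_ne_zero (NeZero.ne L)) _) hη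

omit [NeZero L] in
/-- `η ≤ len` for `1 ≤ L`, `0 ≤ η` (the fine spacing is below the block length). [cite: Balaban1985BackgroundPropagators, (3.41) p.397] -/
theorem hlenη_towerGeom (hL : 1 ≤ L) (hη : 0 ≤ η) : ∀ y : (towerGeom L m n η M).Site, (towerGeom L m n η M).eta ≤ (towerGeom L m n η M).len y := fun y => by
  rw [len_towerGeom]
  have h1 : (1 : ℝ) ≤ (L : ℝ) ^ (n + 1) := one_le_pow₀ (by exact_mod_cast hL)
  calc (towerGeom L m n η M).eta = 1 * η := (one_mul η).symm
    _ ≤ (L : ℝ) ^ (n + 1) * η := mul_le_mul_of_nonneg_right h1 hη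

/-! ## §2 [4] Lemma 2.1 (2.61) at one scale, every exponent -/

omit [NeZero L] in
/-- **(2.61) FOR THE MODEL, EVERY EXPONENT**: `Σ_{y′} e^{−αδ₀d(y,y′)} ≤ c₁(α) = 12c₀(½α)^d` for all `α, δ₀ > 0` and every torus size — one scale has no scale-changing legs,
so no condition (2.59) (pv21's `torusSum_tdist1_le` + `c0_pow_le_c1`). [cite: Balaban1984PropagatorsII, (2.61) p.234] -/
theorem h261_towerGeom (R : ℝ) (H : Prop) {δ₀ α : ℝ} (hα : 0 < α) (hδ : 0 < δ₀) : Ineq261 d (toB6 (towerGeom L m n η M) R H) δ₀ α := fun y =>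
  (torusSum_tdist1_le (N := m) y (mul_pos hα hδ)).trans (c0_pow_le_c1 d hα hδ)

omit [NeZero L] in
/-- (2.61) in the shape of the R1 theorems (`9/5000 ≤ α < 1`). [cite: Balaban1984PropagatorsII, (2.61) p.234] -/
theorem h261_towerGeom_R1 (R : ℝ) (H : Prop) {δ₀ : ℝ} (hδ : 0 < δ₀) :
    ∀ α : ℝ, 9 / 5000 ≤ α → α < 1 → Ineq261 d (toB6 (towerGeom L m n η M) R H) δ₀ α :=
  fun _ hα _ => h261_towerGeom L m n η M R H (by linarith) hδ

/-! ## §3 The p. 398 scale transfers: trivial at one scale -/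

omit [NeZero L] in
/-- A CONSTANT weight transfers at any rate with any constant `Λ ≥ 1`: `e^{−αδ₀d(y,y′)}·c ≤ Λ·c` (`0 ≤ αδ₀`, `0 ≤ c`). [cite: Balaban1985BackgroundPropagators, p.398 (remark after (3.47))] -/
theorem scaleTransfer_const {δ₀ α Λ c : ℝ} (hαδ : 0 ≤ α * δ₀) (hΛ : 1 ≤ Λ) (hc : 0 ≤ c) :
    ScaleTransfer (towerGeom L m n η M) δ₀ α Λ (fun _ => c) := fun y y' => by
  have h1 : Real.exp (-(α * δ₀ * (towerGeom L m n η M).dist y y')) ≤ 1 :=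
    Real.exp_le_one_iff.mpr (by have := mul_nonneg hαδ (hdnn_towerGeom L m n η M y y'); linarith)
  calc Real.exp (-(α * δ₀ * (towerGeom L m n η M).dist y y')) * c ≤ 1 * c := mul_le_mul_of_nonneg_right h1 hc
    _ ≤ Λ * c := mul_le_mul_of_nonneg_right hΛ hc

omit [NeZero L] in
/-- **THE SIX SCALE TRANSFERS of `thm34_Gp_uniform` WITH `Λf ≡ 1`** (every length is the constant `L^{n+1}η`). [cite: Balaban1985BackgroundPropagators, p.398 (remark after (3.47))] -/
theorem hST_towerGeom (hη : 0 ≤ η) {δ₀ : ℝ} (hδ : 0 ≤ δ₀) :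
    ∀ α : ℝ, 0 < α →
      ScaleTransfer (towerGeom L m n η M) δ₀ α 1 (fun a => (towerGeom L m n η M).len a) ∧
      ScaleTransfer (towerGeom L m n η M) δ₀ α 1 (fun a => (towerGeom L m n η M).len a ^ 2) ∧
      ScaleTransfer (towerGeom L m n η M) δ₀ α 1 (fun a => ((towerGeom L m n η M).len a)⁻¹) ∧
      ScaleTransfer (towerGeom L m n η M) δ₀ α 1 (fun a => ((towerGeom L m n η M).len a ^ 2)⁻¹) ∧
      ScaleTransfer (towerGeom L m n η M) δ₀ α 1 (fun a => ((towerGeom L m n η M).len a ^ 4)⁻¹) ∧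
      ScaleTransfer (towerGeom L m n η M) δ₀ α 1 (fun y => (towerGeom L m n η M).len y ^ (-(4 : ℝ))) := by
  intro α hα
  have hαδ : 0 ≤ α * δ₀ := mul_nonneg hα.le hδ
  have hl : 0 ≤ (L : ℝ) ^ (n + 1) * η := mul_nonneg (pow_nonneg (Nat.cast_nonneg _) _) hη
  simp only [len_towerGeom]
  exact ⟨scaleTransfer_const L m n η M hαδ le_rfl hl, scaleTransfer_const L m n η M hαδ le_rfl (sq_nonneg _),
    scaleTransfer_const L m n η M hαδ le_rfl (inv_nonneg.mpr hl), scaleTransfer_const L m n η M hαδ le_rfl (inv_nonneg.mpr (sq_nonneg _)),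
    scaleTransfer_const L m n η M hαδ le_rfl (inv_nonneg.mpr (pow_nonneg hl 4)), scaleTransfer_const L m n η M hαδ le_rfl (Real.rpow_nonneg hl _)⟩

/-! ## §4 The stencil range of the `k`-level block map -/

omit [NeZero L] [∀ i, NeZero (m i)] in
/-- `ℓ¹ ≤ d·ℓ^∞` on the torus: `d₁(y, y′) ≤ d·tdist(y, y′)`. [folklore] [cite: Balaban1984PropagatorsII, (2.46) p.231] -/
theorem tdist1_le_card_mul_tdist [∀ i, NeZero (m i)] (y y' : TSite d m) : tdist1 m y y' ≤ d * tdist m y y' := by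
  unfold tdist1 tdist
  have h : ∀ i ∈ Finset.univ, ((ccoord m y y' i : ℕ) : ℝ) ≤ ((Finset.univ.sup (ccoord m y y') : ℕ) : ℝ) := fun i _ => by
    exact_mod_cast Finset.le_sup (f := ccoord m y y') (Finset.mem_univ i)
  calc ∑ i, ((ccoord m (B5TorusCover.UT.toSite m y) (B5TorusCover.UT.toSite m y') i : ℕ) : ℝ)
      = ∑ i, ((ccoord m y y' i : ℕ) : ℝ) := rfl
    _ ≤ ∑ _i : Fin d, ((Finset.univ.sup (ccoord m y y') : ℕ) : ℝ) := Finset.sum_le_sum h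
    _ = d * ((Finset.univ.sup (ccoord m y y') : ℕ) : ℝ) := by rw [Finset.sum_const, Finset.card_univ, Fintype.card_fin, nsmul_eq_mul]

omit [NeZero L] [∀ i, NeZero (m i)] in
/-- The `k`-level block map IS the one-step block map at block size `L^{n+1}` along the period identity `towerP L m (n+1) = fineP (L^{n+1}) m`.
[cite: Balaban1985Averaging, (2) p.17; Balaban1984PropagatorsI, (1.18) p.20] -/
theorem blkK_eq_blockCoord_siteCast (x : TSite d (towerP L m (n + 1))) :
    blkK L m n x = blockCoord (L ^ (n + 1)) m (siteCast (towerP_eq_fineP_pow L m (n + 1)) x) := by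
  funext i
  apply Fin.ext
  rw [blkK_apply_val, B9Eq319QprimeTorus.blockCoord_apply_val, siteCast_apply_val]

omit [NeZero L] [∀ i, NeZero (m i)] in
/-- The site cast commutes with the unit steps. [folklore] [cite: Balaban1985Averaging, (1)–(2) p.17] -/
theorem siteCast_shift {P P' : Fin d → ℕ} (h : P = P') (μ : Fin d) (x : TSite d P) : siteCast h (shift μ x) = shift μ (siteCast h x) := by
  subst h; rfl

/-- **r06's `hd₀F` WITH `d₀ := d`: `d(blkK x, blkK (x + e_μ)) ≤ d`** — a forward unit step of `T_{L^{n+1}m}` moves the `k`-level block coordinate by at most one coarse unit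
(`tdist_blockCoord_shift_le_one` at block size `L^{n+1}`), hence by at most `d` in `ℓ¹`. [cite: Balaban1985Averaging, (2) p.17; Balaban1985BackgroundPropagators, (3.49) p.399] -/
theorem dist_blkK_shift_le (μ : Fin d) (x : TSite d (towerP L m (n + 1))) :
    (towerGeom L m n η M).dist (blkK L m n x) (blkK L m n (shiftEquiv (Pd := towerP L m (n + 1)) μ x)) ≤ d := by
  have hm : ∀ i, 1 ≤ m i := fun i => Nat.one_le_iff_ne_zero.mpr (NeZero.ne (m i))
  rw [dist_towerGeom]
  refine (tdist1_le_card_mul_tdist m _ _).trans ?_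
  have h1 : tdist m (blkK L m n x) (blkK L m n (shiftEquiv (Pd := towerP L m (n + 1)) μ x)) ≤ 1 := by
    rw [blkK_eq_blockCoord_siteCast, blkK_eq_blockCoord_siteCast, show shiftEquiv (Pd := towerP L m (n + 1)) μ x = shift μ x from rfl, siteCast_shift]
    exact tdist_blockCoord_shift_le_one (L := L ^ (n + 1)) hm _ μ
  calc (d : ℝ) * tdist m (blkK L m n x) (blkK L m n (shiftEquiv (Pd := towerP L m (n + 1)) μ x)) ≤ d * 1 :=
        mul_le_mul_of_nonneg_left h1 (Nat.cast_nonneg _)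
    _ = d := mul_one _

/-- **r06's `hd₀B` WITH `d₀ := d`: `d(blkK x, blkK (x − e_μ)) ≤ d`** (the backward step; symmetry of `d` and `(x − e_μ) + e_μ = x`).
[cite: Balaban1985Averaging, (2) p.17; Balaban1985BackgroundPropagators, (3.49) p.399] -/
theorem dist_blkK_shift_symm_le (μ : Fin d) (x : TSite d (towerP L m (n + 1))) :
    (towerGeom L m n η M).dist (blkK L m n x) (blkK L m n ((shiftEquiv (Pd := towerP L m (n + 1)) μ).symm x)) ≤ d := by
  have h := dist_blkK_shift_le L m n η M μ ((shiftEquiv (Pd := towerP L m (n + 1)) μ).symm x)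
  rw [Equiv.apply_symm_apply, hsym_towerGeom] at h
  exact h

omit [NeZero L] in
/-- **r06's `hd₀0`: `d(y, y) ≤ d₀`** for any `d₀ ≥ 0`. [folklore] [cite: Balaban1984PropagatorsII, (2.46) p.231] -/
theorem dist_self_le {d₀ : ℝ} (hd₀ : 0 ≤ d₀) : ∀ y : (towerGeom L m n η M).Site, (towerGeom L m n η M).dist y y ≤ d₀ := fun y => by
  rw [hrefl_towerGeom]; exact hd₀

end Literature.MathematicalPhysics.QuantumFieldTheory.Balaban1983to89.B9Eq341TowerBlockGeometry

end
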